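import Literature.ModelTheory.Zilber.EACTorusScalings
import Literature.ModelTheory.Zilber.EACProofs
import HarnessLib

/-!
# The multi-coordinate swap: cylinders in several multiplicative coordinates meet the graph of `exp`

Zilber's Exponential-Algebraic Closedness, case ladder (host summit Schanuel, cell `pub-schanuel`).
The swap trick of `EACPeriodicCylinders` (one multiplicative coordinate; Mantova–Masser's "simple
trick" on top of Aslanyan–Kirby–Mantova Thm. 1.5) and Theorem A of
`Summits/…/ZilberEacTorusRuled.lean` (one ruling direction) extended to a SET `I` of coordinates:
this is what the cells `(n, d)` with `d ≤ n - 2` need (there `π(V) + ℂ ν` can never be dense for a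
single `ν`; seat-1 handoff O26: "for `n ≥ 4` the cylinder corner splits further").

* `xySwaps I` — the involution of `Kⁿ × Kⁿ` exchanging `xᵢ ↔ yᵢ` for every `i ∈ I`; `swapSets I W`.
* `IsCoordCylinders W I` — `W` is a cylinder in all the coordinates `yᵢ`, `i ∈ I`, simultaneously
  (from the one-coordinate cylinders: `isCoordCylinders_of_forall`).
* `HasDominantAddProjectionOffSet I V` — `π(V) + Σ_{i ∈ I} K eᵢ` is Zariski dense.
* **Multi-swap** (`inter_expGraph_nonempty_of_cylinders_of_swaps`, `hasDominantAddProjection_swapSets`,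
  `inter_expGraph_nonempty_of_cylinders_of_offSet`): an irreducible closed `W` meeting the torus,
  with additively free torus part, a cylinder in the `yᵢ` (`i ∈ I`) and with `π(V) + Σ_{i∈I} ℂeᵢ`
  dense, meets `Γ_exp` (Aslanyan–Kirby–Mantova Thm. 1.5 on the multi-swapped set).
* **Theorem A_I** (`inter_expGraph_nonempty_of_isTorusStable_coords`): the same with "cylinder in
  `yᵢ`" replaced by "torus part stable under `yᵢ ↦ t yᵢ`" (`IsTorusStable (Pi.single i 1)`), i.e.
  `V` ruled by the coordinate subtorus `T_I`; e.g. in a cell `(n, d)` a `V` ruled by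
  `T_{e_{d+1}, …, e_n}` whose base projects dominantly to the first `d` coordinates.  General ruling
  lattices `Λ ⊆ ℤⁿ` of rank `n - d` reduce to this by a lattice change `Φ_U` with
  `U Λ = ⟨e_i : i ∈ I⟩` (`EACMonomialChange`; the unimodular completion of a saturated sublattice is
  not typed here).

Honest framing: elementary consequences of a published theorem; no open cell is settled;
`ECCell 3 2` OPEN; not Schanuel's conjecture; EAC ⇏ SC.
-/

noncomputable section

open MvPolynomial Matrix

namespace Literature.ModelTheory.Zilber

open Literature.NumberTheory.Transcendental
open Literature.ModelTheory.ExponentialFields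

variable {K : Type*} [Field K] {n : ℕ}

/-! ## The multi-swap `xᵢ ↔ yᵢ` (`i ∈ I`) -/

/-- The map exchanging `inl i ↔ inr i` for all `i ∈ I` (other slots fixed). [folklore] -/
def xySwapsFun (I : Finset (Fin n)) : Fin n ⊕ Fin n → Fin n ⊕ Fin n
  | Sum.inl j => if j ∈ I then Sum.inr j else Sum.inl j
  | Sum.inr j => if j ∈ I then Sum.inl j else Sum.inr j

/-- `xySwapsFun I` is an involution. [folklore] -/
theorem xySwapsFun_involutive (I : Finset (Fin n)) : Function.Involutive (xySwapsFun I) := by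
  intro k
  rcases k with j | j <;> by_cases hj : j ∈ I <;> simp [xySwapsFun, hj]

/-- **The multi-swap** `σ_I` of `Kⁿ × Kⁿ`: the coordinate permutation exchanging `xᵢ` with `yᵢ`
for every `i ∈ I`. [folklore] -/
def xySwaps (I : Finset (Fin n)) : Equiv.Perm (Fin n ⊕ Fin n) :=
  (xySwapsFun_involutive I).toPerm _

/-- `σ_I` on additive slots. [folklore] -/
theorem xySwaps_inl (I : Finset (Fin n)) (j : Fin n) :
    xySwaps I (Sum.inl j) = if j ∈ I then Sum.inr j else Sum.inl j := rfl

/-- `σ_I` on multiplicative slots. [folklore] -/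
theorem xySwaps_inr (I : Finset (Fin n)) (j : Fin n) :
    xySwaps I (Sum.inr j) = if j ∈ I then Sum.inl j else Sum.inr j := rfl

/-- `σ_I ∘ σ_I = id`. [folklore] -/
@[simp] theorem xySwaps_xySwaps (I : Finset (Fin n)) (k : Fin n ⊕ Fin n) :
    xySwaps I (xySwaps I k) = k :=
  xySwapsFun_involutive I k

omit [Field K] in
/-- `(z ∘ σ_I) ∘ σ_I = z`. [folklore] -/
@[simp] theorem comp_xySwaps_comp_xySwaps (I : Finset (Fin n)) (z : Fin n ⊕ Fin n → K) :
    (z ∘ xySwaps I) ∘ xySwaps I = z := by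
  funext k
  simp

/-- **The multi-swapped set** `W♯ = {z | z ∘ σ_I ∈ W}`. [folklore] -/
def swapSets (I : Finset (Fin n)) (W : Set (Fin n ⊕ Fin n → K)) : Set (Fin n ⊕ Fin n → K) :=
  {z | z ∘ xySwaps I ∈ W}

omit [Field K] in
/-- `w ∘ σ_I ∈ W♯ ↔ w ∈ W`. [folklore] -/
theorem comp_xySwaps_mem_swapSets_iff (I : Finset (Fin n)) (W : Set (Fin n ⊕ Fin n → K))
    (w : Fin n ⊕ Fin n → K) : w ∘ xySwaps I ∈ swapSets I W ↔ w ∈ W := by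
  change (w ∘ xySwaps I) ∘ xySwaps I ∈ W ↔ w ∈ W
  rw [comp_xySwaps_comp_xySwaps]

/-- `W♯` is Zariski closed if `W` is. [folklore] -/
theorem isZariskiClosed_swapSets (I : Finset (Fin n)) {W : Set (Fin n ⊕ Fin n → K)}
    (hW : IsZariskiClosed K W) : IsZariskiClosed K (swapSets I W) :=
  isZariskiClosed_setOf_comp_mem (xySwaps I) hW

/-! ## Cylinders in several coordinates -/

/-- `W` is a **cylinder in all the multiplicative coordinates `yᵢ`, `i ∈ I`**: membership does not
depend on those coordinates. [folklore] -/
def IsCoordCylinders (W : Set (Fin n ⊕ Fin n → K)) (I : Finset (Fin n)) : Prop :=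
  ∀ z ∈ W, ∀ z' : Fin n ⊕ Fin n → K, (∀ k, k ∉ (I.image Sum.inr : Finset (Fin n ⊕ Fin n)) → z' k = z k) →
    z' ∈ W

omit [Field K] in
/-- One-coordinate cylinders in every `yᵢ`, `i ∈ I`, give the simultaneous cylinder (update the
coordinates one at a time). [folklore] -/
theorem isCoordCylinders_of_forall {W : Set (Fin n ⊕ Fin n → K)}
    {I : Finset (Fin n)} (h : ∀ i ∈ I, IsCoordCylinder W (Sum.inr i)) : IsCoordCylinders W I := by
  classical
  induction I using Finset.induction_on with
  | empty =>
    intro z hz z' hz'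
    have : z' = z := funext fun k => hz' k (by simp)
    rwa [this]
  | insert i I hi ih =>
    intro z hz z' hz'
    have hI : IsCoordCylinders W I := ih fun j hj => h j (Finset.mem_insert_of_mem hj)
    -- first reset the `i`-th coordinate, then use the induction hypothesis
    have hz'' : Function.update z' (Sum.inr i) (z (Sum.inr i)) ∈ W := by
      refine hI z hz _ fun k hk => ?_
      by_cases hki : k = Sum.inr i
      · subst hki
        rw [Function.update_self]
      · rw [Function.update_of_ne hki]
        refine hz' k fun hk' => ?_
        rw [Finset.image_insert, Finset.mem_insert] at hk'
        rcases hk' with hk' | hk'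
        · exact hki hk'
        · exact hk hk'
    have := h i (Finset.mem_insert_self i I) _ hz'' (z' (Sum.inr i))
    rwa [Function.update_idem, Function.update_eq_self] at this

/-! ## The multi-swap trick -/

/-- **The multi-swap trick.** `W` Zariski closed, a cylinder in the `yᵢ` (`i ∈ I`), and the torus
part of `W♯ = {z | z ∘ σ_I ∈ W}` projecting dominantly to the additive factor ⇒ `W` meets the graph
of `exp` (Aslanyan–Kirby–Mantova Thm. 1.5 on `W♯`, pull back along `σ_I`, reset `yᵢ := exp xᵢ`
for `i ∈ I`). [cite: AslanyanKirbyMantova2021, Thm. 1.5] -/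
theorem inter_expGraph_nonempty_of_cylinders_of_swaps {W : Set (Fin n ⊕ Fin n → ℂ)}
    (hW : IsZariskiClosed ℂ W) {I : Finset (Fin n)} (hcyl : IsCoordCylinders W I)
    (hdom : HasDominantAddProjection ℂ (swapSets I W ∩ torusLocus ℂ n)) :
    (W ∩ expGraph ℂ n).Nonempty := by
  classical
  obtain ⟨z, hzW, hzE⟩ := aslanyanKirbyMantova2023_thm_1_5_holds n (swapSets I W)
    (isZariskiClosed_swapSets I hW) hdom
  have hwW : z ∘ xySwaps I ∈ W := hzW
  set w := z ∘ xySwaps I with hw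
  -- reset the swapped multiplicative coordinates to exponentials
  let w' : Fin n ⊕ Fin n → ℂ := fun k =>
    match k with
    | Sum.inl j => w (Sum.inl j)
    | Sum.inr j => if j ∈ I then ExponentialRing.exp (w (Sum.inl j)) else w (Sum.inr j)
  refine ⟨w', hcyl w hwW w' fun k hk => ?_, ?_⟩
  · rcases k with j | j
    · rfl
    · have hj : j ∉ I := fun hj => hk (Finset.mem_image_of_mem _ hj)
      simp [w', hj]
  · rw [mem_expGraph_iff]
    intro j
    by_cases hj : j ∈ I
    · simp [w', hj]
    · simp only [w', hj, if_false, hw, Function.comp_apply, xySwaps_inr, xySwaps_inl]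
      exact (mem_expGraph_iff.1 hzE) j

variable (K) in
/-- **`π(V) + Σ_{i ∈ I} K·eᵢ` is Zariski dense in `Kⁿ`**: no nonzero polynomial vanishes at all
points obtained from `π(z)`, `z ∈ V`, by overwriting the coordinates in `I` arbitrarily.
[folklore] -/
def HasDominantAddProjectionOffSet (I : Finset (Fin n)) (V : Set (Fin n ⊕ Fin n → K)) : Prop :=
  ∀ p : MvPolynomial (Fin n) K,
    (∀ z ∈ V, ∀ t : Fin n → K, eval (fun j => if j ∈ I then t j else projAdd z j) p = 0) → p = 0

/-- **Dominance of the multi-swap.** `W` irreducible closed meeting the torus, `V = W ∩ Gⁿ`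
additively free, `W` a cylinder in the `yᵢ` (`i ∈ I`), `π(V) + Σ_{i∈I} K eᵢ` dense ⇒ `W♯ ∩ Gⁿ`
projects dominantly: a relation on `W♯ ∩ Gⁿ` pulls back to `p♮` vanishing on `V ∩ {xᵢ ≠ 0, i ∈ I}`,
so `p♮ · ∏_{i∈I} Xᵢ ∈ I(W)` (prime; no `Xᵢ ∈ I(W)` by additive freeness), so `p♮ ∈ I(W)`, and the
cylinders make `p` vanish on `π(V) + Σ K eᵢ`. [folklore] -/
theorem hasDominantAddProjection_swapSets {W : Set (Fin n ⊕ Fin n → K)}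
    (hW : IsIrreducibleClosed K W) (hne : (W ∩ torusLocus K n).Nonempty)
    (hadd : IsAddFree K n (W ∩ torusLocus K n)) {I : Finset (Fin n)} (hcyl : IsCoordCylinders W I)
    (hoff : HasDominantAddProjectionOffSet K I (W ∩ torusLocus K n)) :
    HasDominantAddProjection K (swapSets I W ∩ torusLocus K n) := by
  classical
  intro p hp
  set q : MvPolynomial (Fin n ⊕ Fin n) K := rename (fun j => xySwaps I (Sum.inl j)) p with hq
  have hq_eval : ∀ w : Fin n ⊕ Fin n → K,
      aeval w q = eval (fun j => w (xySwaps I (Sum.inl j))) p := by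
    intro w
    rw [hq, aeval_rename]
    rfl
  -- (1) `p♮` vanishes at the points of `V` with `xᵢ ≠ 0` for all `i ∈ I`
  have h1 : ∀ w ∈ W ∩ torusLocus K n, (∀ i ∈ I, w (Sum.inl i) ≠ 0) → aeval w q = 0 := by
    intro w hw hwi
    rw [hq_eval]
    have hz : w ∘ xySwaps I ∈ swapSets I W ∩ torusLocus K n := by
      refine ⟨(comp_xySwaps_mem_swapSets_iff I W w).2 hw.1, fun j => ?_⟩
      simp only [Function.comp_apply, xySwaps_inr]
      split_ifs with hj
      · exact hwi j hj
      · exact hw.2 j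
    have hfun : (fun j => w (xySwaps I (Sum.inl j))) = projAdd (w ∘ xySwaps I) := by
      funext j
      rfl
    rw [hfun]
    exact hp _ hz
  -- (2) `p♮ · ∏ Xᵢ ∈ I(W)`, hence `p♮ ∈ I(W)`
  have hIV := vanishingIdeal_inter_torusLocus_of_irred hW hne
  haveI : (vanishingIdeal K W).IsPrime := hW.2
  have h2 : q * ∏ i ∈ I, X (Sum.inl i) ∈ vanishingIdeal K W := by
    rw [← hIV, mem_vanishingIdeal_iff]
    intro w hw
    rw [map_mul, map_prod]
    by_cases hwi : ∀ i ∈ I, w (Sum.inl i) ≠ 0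
    · rw [h1 w hw hwi, zero_mul]
    · push Not at hwi
      obtain ⟨i, hi, hwi⟩ := hwi
      rw [Finset.prod_eq_zero hi (by rw [aeval_X, hwi]), mul_zero]
  have hprod : (∏ i ∈ I, X (Sum.inl i) : MvPolynomial (Fin n ⊕ Fin n) K) ∉ vanishingIdeal K W := by
    intro h
    obtain ⟨i, -, hi⟩ := Ideal.IsPrime.prod_mem_iff.mp h
    exact X_inl_notMem_vanishingIdeal_of_isAddFree hadd i
      (vanishingIdeal_anti_mono Set.inter_subset_left hi)
  have hqW : q ∈ vanishingIdeal K W := ((hW.2).mem_or_mem h2).resolve_right hprod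
  -- (3) cylinders: `p` vanishes on `π(V) + Σ K eᵢ`
  refine hoff p fun z hz t => ?_
  let z' : Fin n ⊕ Fin n → K := fun k =>
    match k with
    | Sum.inl j => z (Sum.inl j)
    | Sum.inr j => if j ∈ I then t j else z (Sum.inr j)
  have hz' : z' ∈ W := hcyl z hz.1 z' fun k hk => by
    rcases k with j | j
    · rfl
    · have hj : j ∉ I := fun hj => hk (Finset.mem_image_of_mem _ hj)
      simp [z', hj]
  have h3 := (mem_vanishingIdeal_iff.1 hqW) _ hz'
  rw [hq_eval] at h3
  have hfun : (fun j => z' (xySwaps I (Sum.inl j))) = fun j => if j ∈ I then t j else projAdd z j := by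
    funext j
    rw [xySwaps_inl]
    by_cases hj : j ∈ I
    · simp [z', hj]
    · simp [z', hj, projAdd_apply]
  rw [hfun] at h3
  exact h3

/-- **Cylinders in the `yᵢ` (`i ∈ I`) with `π(V) + Σ_{i∈I} ℂ eᵢ` dense meet the graph of `exp`.**
[cite: AslanyanKirbyMantova2021, Thm. 1.5] -/
theorem inter_expGraph_nonempty_of_cylinders_of_offSet {W : Set (Fin n ⊕ Fin n → ℂ)}
    (hW : IsIrreducibleClosed ℂ W) (hne : (W ∩ torusLocus ℂ n).Nonempty)
    (hadd : IsAddFree ℂ n (W ∩ torusLocus ℂ n)) {I : Finset (Fin n)} (hcyl : IsCoordCylinders W I)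
    (hoff : HasDominantAddProjectionOffSet ℂ I (W ∩ torusLocus ℂ n)) :
    (W ∩ expGraph ℂ n).Nonempty :=
  inter_expGraph_nonempty_of_cylinders_of_swaps hW.1 hcyl
    (hasDominantAddProjection_swapSets hW hne hadd hcyl hoff)

/-! ## Theorem A_I: ruling by a coordinate subtorus -/

/-- A closed `W` whose torus part is stable under `yᵢ ↦ t yᵢ` is a cylinder in `yᵢ` (the closure of
`W ∩ Gⁿ`, which is `W` when `W` is irreducible and meets the torus, is one). [folklore] -/
theorem isCoordCylinder_of_isTorusStable_single {W : Set (Fin n ⊕ Fin n → ℂ)}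
    (hW : IsIrreducibleClosed ℂ W) (hne : (W ∩ torusLocus ℂ n).Nonempty) {i : Fin n}
    (hst : IsTorusStable (Pi.single i 1) (W ∩ torusLocus ℂ n)) : IsCoordCylinder W (Sum.inr i) := by
  classical
  have hWZ : W = zeroLocus ℂ (vanishingIdeal ℂ (W ∩ torusLocus ℂ n)) := by
    rw [vanishingIdeal_inter_torusLocus hW hne]
    exact eq_zeroLocus_vanishingIdeal_of_isZariskiClosed hW.1
  rw [hWZ]
  refine isCoordCylinder_zeroLocus_vanishingIdeal_of_scale one_ne_zero (fun z hz => hz.2 i)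
    fun z hz t ht => ?_
  rw [← torusScale_single]
  exact hst z hz t ht

/-- **Theorem A_I (ruling by a coordinate subtorus).** `W` irreducible closed, `V = W ∩ Gⁿ ≠ ∅`
additively free and stable under `yᵢ ↦ t yᵢ` for every `i ∈ I`, `π(V) + Σ_{i∈I} ℂ eᵢ` Zariski dense
⇒ `W` meets the graph of `exp`.  (For a cell `(n, d)`: `|I| = n - d` and the base projects dominantly
to the coordinates outside `I`; general ruling lattices reduce to this by a lattice change `Φ_U`.)
[cite: AslanyanKirbyMantova2021, Thm. 1.5] -/
theorem inter_expGraph_nonempty_of_isTorusStable_coords {W : Set (Fin n ⊕ Fin n → ℂ)}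
    (hW : IsIrreducibleClosed ℂ W) (hne : (W ∩ torusLocus ℂ n).Nonempty)
    (hadd : IsAddFree ℂ n (W ∩ torusLocus ℂ n)) {I : Finset (Fin n)}
    (hst : ∀ i ∈ I, IsTorusStable (Pi.single i 1) (W ∩ torusLocus ℂ n))
    (hoff : HasDominantAddProjectionOffSet ℂ I (W ∩ torusLocus ℂ n)) :
    (W ∩ expGraph ℂ n).Nonempty := by
  classical
  exact inter_expGraph_nonempty_of_cylinders_of_offSet hW hne hadd
    (isCoordCylinders_of_forall fun i hi => isCoordCylinder_of_isTorusStable_single hW hne (hst i hi))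
    hoff

end Literature.ModelTheory.Zilber
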